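import Summits.QuantumFields.BalabanUV.Beta.FP.TorusCompositeSlice
import Summits.QuantumFields.BalabanUV.Beta.FP.TorusCompositeFP

/-!
# `BalabanUV.Beta.FP.TorusCompositeSliceOneShot` — road «FP» for binder row D1, ROUTE T, SPEC-27 (SLICE-m) part 3b, OPTION (α) of the located
# question F-d1leaf06g21-1: **THE FINE SYSTEM SLICED BY ITS OWN ONE-SHOT BIG COMB** — with `τ₁ := bigP Lc (fine Lc M′) (rs ∘ succ) _ n` (the
# `(n+1)`-fold composite's one-shot comb of ratio `Lc^{n+1}` on the finest torus; EQUAL to the registered `nestedSlice (fine Lc M′) … n` at `n = 0`: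
# `bigP_zero = combF = nestedSlice_zero`) the composite call's (SLICE-m) letters close at EVERY depth from LANDED theorems: `hTW` from `hPW^{(n)}`
# (`TorusCompositeUnimodular.det_bigP_mul_towerGen_ne_zero`, p328699) + leaf-02's c0 + the top block, and the fine dead rows `s1 s2` from «the
# direction is dead on that comb's bonds» (the p-type lemma at every depth) — NOT FILED before the OWNER's ruling on (α)

WHAT.  §1 `bigP_mul_eq_zero_of_vanish_on_bigComb`: at every depth `n`, the one-shot comb slice `bigP Lc M rs _ n` kills any matrix vanishing at the slots
`(s, α)` with `IsCombBondAt (bigRoot Lc rs n) (bigRatio Lc n) α s` on the finest torus (`CombSliceRowJets.combSlice_mul_eq_zero_of_vanish_on_dead` at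
`e := towerEquiv`, `isCombBondAt_of_combBondT_eq` with `bigRatio_dvd_towerTorus`) — the depth-`n` twin of g18's `torus_p_of_vanish_on_bigComb`.  §2 the fine
dead rows of the composite call UNDER OPTION (α): `torus_s1_oneShot_tower ∕ torus_s2_oneShot_tower` — `τ₁ * W₁ = 0`, `τ₁ * W₂ = 0` for #17's pinned
exponential closed forms `W₁ = of (−c·h b·evalN … tip b e)`, `W₂ = of ((c·h b)²·evalN … tip b e)` from `hdead : h = 0` on the bonds of the depth-`n` big comb
of `fine Lc M′` (g19's `torus_s1_of_dead ∕ torus_s2_of_dead` are the case `n = 0`).  §3 `torus_hTW_oneShot_tower`: `(fromRows (τ₂ * Q₁₀) τ₁ * W₀).det ≠ 0` at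
`hτ₂ : τ₂ = combF Lc M′ (rs 0)`, `hQ₁₀ : Q₁₀ = compRows … (n+1)`, `hτ₁ : τ₁ = bigP Lc (fine Lc M′) … n`, `hW₀ : W₀ = towerGen … (n+1)` — the depth-1 generic
`det_nestedSlice_mul_gauge_ne_zero` with `|det (τ₁ D₁)| ≠ 0 := det_bigP_mul_towerGen_ne_zero … n` (landed `hPW` one level down), the two covariance
letters from leaf-02's `compRows_mul_towerGen_succ`, the top block `TorusCompositeSlice.det_combF_mul_smul_tgrad_res_ne_zero`.  [folklore] linear algebra
over OUR tower objects; no `def`, no `def … : Prop`, nothing cited, 0 sorry.  Nothing of the dictionary ∕ Bałaban's asserted.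

HONEST DEPENDENCY (page 1, mandatory): continuum YM on T⁴ ⇐ BetaPertH ∧ nine spine estimates (0/9 proved); BetaPertH ⇐ (D1) ∧ (D4) ∧ CAP+tail;
G-an2-4 gates asym, D1 and NE2/3/4.  HONEST FRAMING (cell contract, verbatim): «discharging `BetaPertH` makes Bałaban's UV stability UNCONDITIONAL —
a real constructive-QFT result; it is NOT the continuum limit and NOT the Clay problem.»  ABSOLUTE RULE (cell charter, verbatim): «No internally-minted
statement may enter as a cited fact. Every hypothesis is either kernel-proved in this package or a verbatim quotation of a PUBLISHED theorem with page
reference. The manuscript(s) under audit are NOT citable for their own disputed steps — they are the thing under adjudication; programme-internal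
(2001/route/tribunal) claims are never citable.»  0 estimates; 0∕4 row-D1 binders; NOT (T-ID), NOT SDF, NOT D1, NOT BetaPertH, NOT continuum, NOT Clay.
D1 formalisation swarm LEAF PROVER 06 (b2b-balaban-beta-d1-formalise-leaf-06 gen 21), 2026-08-22.  No existing file touched.
-/

noncomputable section

open scoped BigOperators

namespace Summit.QuantumFields.BalabanUV.Beta.FP.TorusCompositeSliceOneShot

open Matrix Finset
open Literature.MathematicalPhysics.QuantumFieldTheory.Balaban1983to89
open Literature.MathematicalPhysics.QuantumFieldTheory.Balaban1983to89.Beta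
open B5Prop11Plancherel (fine)
open B6Lemma24Torus (pbox)
open AffineAveraging (Site box toSite unitVec)
open OneStepResolventKernel (Fib)
open Summit.QuantumFields.BalabanUV.Beta.BorderedHessian (stepScale)
open Summit.QuantumFields.BalabanUV.Beta.AxialDressingRooted (IsCombBondAt)
open Summit.QuantumFields.BalabanUV.Beta.FP.KernelPeriodisationFib (Idx)
open Summit.QuantumFields.BalabanUV.Beta.FP.TorusGaugeCovariance (tgrad)
open Summit.QuantumFields.BalabanUV.Beta.FP.TorusGaugeCovarianceCoarse (tgradBlock)
open Summit.QuantumFields.BalabanUV.Beta.FP.TorusCombRows (Res combRowsT)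
open Summit.QuantumFields.BalabanUV.Beta.FP.CombSliceRowJets (combSlice_mul_eq_zero_of_vanish_on_dead isCombBondAt_of_combBondT_eq)
open Summit.QuantumFields.BalabanUV.Beta.FP.NestedStepLawOneShotLetters (det_nestedSlice_mul_gauge_ne_zero)
open Summit.QuantumFields.BalabanUV.Beta.FP.NestedStepLawTorusInstance (dvd_fine)
open Summit.QuantumFields.BalabanUV.Beta.FP.TorusCompositeObjects
open Summit.QuantumFields.BalabanUV.Beta.FP.TorusCompositeUnimodular (bigRatio_dvd_towerTorus det_bigP_mul_towerGen_ne_zero)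
open Summit.QuantumFields.BalabanUV.Beta.D1BFx.LogDetSecondVariation (secondVar)
open Summit.QuantumFields.BalabanUV.Beta.FP.TorusCompositeFP (evalN torus_uP_exp_tower)
open Summit.QuantumFields.BalabanUV.Beta.FP.TorusCompositeCovariance (compRows_mul_towerGen_succ)
open Summit.QuantumFields.BalabanUV.Beta.FP.TorusCompositeSlice (det_combF_mul_smul_tgrad_res_ne_zero prod_stepScale_mul_card_ne_zero)
open Summit.QuantumFields.BalabanUV.Beta.GAN24.FineReadoutCauchyFrame (toSite_mem_range)

variable {d : ℕ}

/-! ## §1 The one-shot comb slice of the tower kills matrices vanishing on its comb's bonds, at every depth -/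

section BigCombDead

variable (Lc : ℕ) [NeZero Lc]

/-- [folklore] **`bigP · W = 0` FOR `W` VANISHING ON THE BIG COMB's BONDS, AT EVERY DEPTH** (the depth-`n` twin of g18's `torus_p_of_vanish_on_bigComb`):
the one-shot comb slice `bigP Lc M rs _ n` (big comb of ratio `bigRatio Lc n = Lc^{n+1}`, root `bigRoot Lc rs n`, on the finest torus `towerTorus Lc M n`, rows
sorted `NParam` by `towerEquiv`) kills any matrix whose rows vanish at every slot `(s, α)` with `IsCombBondAt (bigRoot Lc rs n) (bigRatio Lc n) α s`
(`Lc ∣ M i`). -/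
theorem bigP_mul_eq_zero_of_vanish_on_bigComb (M : Fin (d + 1) → ℕ) [∀ μ, NeZero (M μ)] (rs : ℕ → (Fin (d + 1) → ℕ))
    (hrs : ∀ k, rs k ∈ box (d + 1) Lc) (hM : ∀ i, Lc ∣ M i) (n : ℕ) {σ : Type*}
    (W : Matrix (↥(pbox (towerTorus Lc M n)) × Fin (d + 1)) σ ℝ)
    (hW : ∀ b : ↥(pbox (towerTorus Lc M n)) × Fin (d + 1), IsCombBondAt (bigRoot Lc rs n) (bigRatio Lc n) b.2 (b.1 : Site (d + 1)) → W b = 0) :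
    bigP Lc M rs (fun k => toSite_mem_range (hrs k)) n * W = 0 :=
  have hLc : 0 < Lc := Nat.pos_of_ne_zero (NeZero.ne Lc)
  combSlice_mul_eq_zero_of_vanish_on_dead (towerEquiv Lc M rs (fun k => toSite_mem_range (hrs k)) n) W fun b _ h =>
    hW b (isCombBondAt_of_combBondT_eq (bigRatio_pos Lc hLc n) (bigRoot_range Lc hLc n rs (fun k => toSite_mem_range (hrs k)))
      (bigRatio_dvd_towerTorus Lc hM n) h)

end BigCombDead

/-! ## §2 OPTION (α): the fine dead rows `s1 ∕ s2` of the composite call with the fine system sliced by its own one-shot big comb -/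

section FineDead

variable (M' : Fin (d + 1) → ℕ) [∀ μ, NeZero (M' μ)] (Lc : ℕ) [NeZero Lc] (rs : ℕ → (Fin (d + 1) → ℕ)) (n : ℕ)

/-- [folklore] **`s1` UNDER OPTION (α)** — `τ₁ * W₁ = 0` for `τ₁ := bigP Lc (fine Lc M′) (rs ∘ succ) _ n` (the `(n+1)`-fold composite's one-shot comb slice;
= the registered `nestedSlice … n` at `n = 0`) and #17's pinned generator first jet `W₁ = of (−c·h b·evalN Lc M′ rs (n+1) tip b e)`, from `hdead : h = 0` on
the bonds of that comb.  (`τ₁`'s column type is the call's `↥(pbox (towerTorus Lc M′ (n+1))) × Fin (d+1)`, which IS `towerTorus Lc (fine Lc M′) n`'s.) -/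
theorem torus_s1_oneShot_tower (hrs : ∀ k, rs k ∈ box (d + 1) Lc) (c : ℝ) (h : ↥(pbox (towerTorus Lc M' (n + 1))) × Fin (d + 1) → ℝ)
    {τ₁ : Matrix (NParam Lc (fine Lc M') (fun k => rs (k + 1)) n) (↥(pbox (towerTorus Lc M' (n + 1))) × Fin (d + 1)) ℝ}
    (hτ₁ : τ₁ = bigP Lc (fine Lc M') (fun k => rs (k + 1)) (fun k => toSite_mem_range (hrs (k + 1))) n)
    {W₁ : Matrix (↥(pbox (towerTorus Lc M' (n + 1))) × Fin (d + 1)) (NParam Lc M' rs (n + 1)) ℝ}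
    (hW₁ : W₁ = Matrix.of fun (b : ↥(pbox (towerTorus Lc M' (n + 1))) × Fin (d + 1)) (e : NParam Lc M' rs (n + 1)) =>
        -(c * h b * evalN Lc M' rs (n + 1) (fun b' : ↥(pbox (towerTorus Lc M' (n + 1))) × Fin (d + 1) => (b'.1 : Site (d + 1)) + unitVec b'.2) b e))
    (hdead : ∀ b : ↥(pbox (towerTorus Lc M' (n + 1))) × Fin (d + 1),
      IsCombBondAt (bigRoot Lc (fun k => rs (k + 1)) n) (bigRatio Lc n) b.2 (b.1 : Site (d + 1)) → h b = 0) :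
    τ₁ * W₁ = 0 := by
  subst hτ₁ hW₁
  exact bigP_mul_eq_zero_of_vanish_on_bigComb Lc (fine Lc M') (fun k => rs (k + 1)) (fun k => hrs (k + 1)) (dvd_fine M') n _ fun b hb => by
    funext e; simp only [Matrix.of_apply, hdead b hb, mul_zero, zero_mul, neg_zero, Pi.zero_apply]

/-- [folklore] **`s2` UNDER OPTION (α)** — `τ₁ * W₂ = 0` for the exponential second jet `W₂ = of ((c·h b)²·evalN … tip b e)`, from the SAME `hdead`. -/
theorem torus_s2_oneShot_tower (hrs : ∀ k, rs k ∈ box (d + 1) Lc) (c : ℝ) (h : ↥(pbox (towerTorus Lc M' (n + 1))) × Fin (d + 1) → ℝ)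
    {τ₁ : Matrix (NParam Lc (fine Lc M') (fun k => rs (k + 1)) n) (↥(pbox (towerTorus Lc M' (n + 1))) × Fin (d + 1)) ℝ}
    (hτ₁ : τ₁ = bigP Lc (fine Lc M') (fun k => rs (k + 1)) (fun k => toSite_mem_range (hrs (k + 1))) n)
    {W₂ : Matrix (↥(pbox (towerTorus Lc M' (n + 1))) × Fin (d + 1)) (NParam Lc M' rs (n + 1)) ℝ}
    (hW₂ : W₂ = Matrix.of fun (b : ↥(pbox (towerTorus Lc M' (n + 1))) × Fin (d + 1)) (e : NParam Lc M' rs (n + 1)) =>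
        (c * h b) ^ 2 * evalN Lc M' rs (n + 1) (fun b' : ↥(pbox (towerTorus Lc M' (n + 1))) × Fin (d + 1) => (b'.1 : Site (d + 1)) + unitVec b'.2) b e)
    (hdead : ∀ b : ↥(pbox (towerTorus Lc M' (n + 1))) × Fin (d + 1),
      IsCombBondAt (bigRoot Lc (fun k => rs (k + 1)) n) (bigRatio Lc n) b.2 (b.1 : Site (d + 1)) → h b = 0) :
    τ₁ * W₂ = 0 := by
  subst hτ₁ hW₂
  exact bigP_mul_eq_zero_of_vanish_on_bigComb Lc (fine Lc M') (fun k => rs (k + 1)) (fun k => hrs (k + 1)) (dvd_fine M') n _ fun b hb => by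
    funext e
    simp only [Matrix.of_apply, hdead b hb, mul_zero, ne_eq, OfNat.ofNat_ne_zero, not_false_eq_true, zero_pow, zero_mul, Pi.zero_apply]

end FineDead

/-! ## §3 OPTION (α): `hTW` with the fine system sliced by its own one-shot big comb — from `hPW` one level down -/

section Pairing

variable (M' : Fin (d + 1) → ℕ) [∀ μ, NeZero (M' μ)] (Lc : ℕ) [NeZero Lc] (lev : ℕ → ℕ) (rs : ℕ → (Fin (d + 1) → ℕ)) (n : ℕ)

/-- [folklore] **`hTW` UNDER OPTION (α)**: `(fromRows (τ₂ * Q₁₀) τ₁ * W₀).det ≠ 0` with the call's `hτ₂ hQ₁₀ hW₀` VERBATIM and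
`hτ₁ : τ₁ = bigP Lc (fine Lc M′) (rs ∘ succ) _ n` — the depth-1 generic `NestedStepLawOneShotLetters.det_nestedSlice_mul_gauge_ne_zero` with
`|det (τ₁ · towerGen_low)| ≠ 0 := det_bigP_mul_towerGen_ne_zero … n` (`hPW` at depth `n`, landed), the two covariance letters `Q₁₀ D₁ = 0`, `Q₁₀ D₂ = σ • D̄` =
the blocks of leaf-02's `compRows_mul_towerGen_succ` (entrywise, `rfl`), and the top block `det (combF · (σ • D̄)) ≠ 0`. -/
theorem torus_hTW_oneShot_tower (hrs : ∀ k, rs k ∈ box (d + 1) Lc) (hM' : ∀ i, Lc ∣ M' i)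
    {Q₁₀ : Matrix (↥(pbox M') × Fin (d + 1)) (↥(pbox (towerTorus Lc M' (n + 1))) × Fin (d + 1)) ℝ}
    {τ₁ : Matrix (NParam Lc (fine Lc M') (fun k => rs (k + 1)) n) (↥(pbox (towerTorus Lc M' (n + 1))) × Fin (d + 1)) ℝ}
    (hQ₁₀ : Q₁₀ = compRows Lc M' lev rs (n + 1))
    (hτ₁ : τ₁ = bigP Lc (fine Lc M') (fun k => rs (k + 1)) (fun k => toSite_mem_range (hrs (k + 1))) n)
    {τ₂ : Matrix (Res (toSite (rs 0)) Lc M') (↥(pbox M') × Fin (d + 1)) ℝ} (hτ₂ : τ₂ = combF Lc M' (rs 0))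
    {W₀ : Matrix (↥(pbox (towerTorus Lc M' (n + 1))) × Fin (d + 1)) (NParam Lc M' rs (n + 1)) ℝ} (hW₀ : W₀ = towerGen Lc M' rs (n + 1)) :
    (Matrix.fromRows (τ₂ * Q₁₀) τ₁ * W₀).det ≠ 0 := by
  subst hQ₁₀ hτ₁ hτ₂ hW₀
  have c0 := compRows_mul_towerGen_succ Lc n M' lev rs hrs
  exact det_nestedSlice_mul_gauge_ne_zero
    (bigP Lc (fine Lc M') (fun k => rs (k + 1)) (fun k => toSite_mem_range (hrs (k + 1))) n) (combF Lc M' (rs 0)) (compRows Lc M' lev rs (n + 1))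
    (towerGen Lc (fine Lc M') (fun k => rs (k + 1)) n)
    ((tgradBlock M' (bigRatio Lc n)).submatrix
      (fun b : ↥(pbox (towerTorus Lc (fine Lc M') n)) × Fin (d + 1) =>
        ((pboxCongr (towerTorus_fine_eq_fine Lc M' n) b.1, Sum.inl b.2) : Idx (fine (bigRatio Lc n) M') (Fib d)))
      (Subtype.val : Res (toSite (rs 0)) Lc M' → ↥(pbox M')))
    ((∏ i ∈ range (n + 1), (stepScale d Lc (lev (i + 1)) * ((box (d + 1) Lc).card : ℝ))) •
      (tgrad M').submatrix (fun a : ↥(pbox M') × Fin (d + 1) => ((a.1, Sum.inl a.2) : Idx M' (Fib d)))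
        (fun t : Res (toSite (rs 0)) Lc M' => (t.1 : ↥(pbox M'))))
    (Matrix.ext fun a y => congrFun (congrFun c0 a) (Sum.inr y))
    (Matrix.ext fun a t => congrFun (congrFun c0 a) (Sum.inl t))
    rfl rfl
    (abs_ne_zero.mpr (det_bigP_mul_towerGen_ne_zero Lc (fine Lc M') (fun k => rs (k + 1)) (fun k => toSite_mem_range (hrs (k + 1))) (dvd_fine M') n))
    (abs_ne_zero.mpr (det_combF_mul_smul_tgrad_res_ne_zero Lc M' (hrs 0) hM' (prod_stepScale_mul_card_ne_zero (d := d) Lc lev (n + 1))))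

end Pairing

/-! ## §4 OPTION (α): the fine chart's Faddeev–Popov 2-jet is AUTOMATIC one level down (the `uLow` letter of `FP/NestedFPSplit`, no `hdead`) -/

section FineFP

variable (M' : Fin (d + 1) → ℕ) [∀ μ, NeZero (M' μ)] (Lc : ℕ) [NeZero Lc] (rs : ℕ → (Fin (d + 1) → ℕ)) (n : ℕ)

/-- [folklore] **`uLow` UNDER OPTION (α) IS leaf-06 g20's `torus_uP_exp_tower` ONE LEVEL DOWN**: with `τ₁ := bigP Lc (fine Lc M′) (rs ∘ succ) _ n`,
`W₀ := towerGen Lc M′ rs (n+1)` and #17's pinned exponential jets `W₁ W₂` along ANY direction `h`, the LOWER column blocks (`toCols₂`: the tower below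
`fine Lc M′` — `towerGen_succ ∕ evalN_succ`, `rfl`) satisfy `secondVar (τ₁ · W₀ˡᵒʷ) (τ₁ · W₁ˡᵒʷ) (τ₁ · W₂ˡᵒʷ) = 0` — NO `hdead`, no comb-support hypothesis
on `h` (the `uLow` input of `NestedFPSplit.secondVar_nestedFP_eq_zero_of_t_uLow`, which then replaces `s1 s2`). -/
theorem torus_uLow_oneShot_tower (hrs : ∀ k, rs k ∈ box (d + 1) Lc) (c : ℝ)
    (h : ↥(pbox (towerTorus Lc M' (n + 1))) × Fin (d + 1) → ℝ)
    {τ₁ : Matrix (NParam Lc (fine Lc M') (fun k => rs (k + 1)) n) (↥(pbox (towerTorus Lc M' (n + 1))) × Fin (d + 1)) ℝ}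
    (hτ₁ : τ₁ = bigP Lc (fine Lc M') (fun k => rs (k + 1)) (fun k => toSite_mem_range (hrs (k + 1))) n)
    {W₀ : Matrix (↥(pbox (towerTorus Lc M' (n + 1))) × Fin (d + 1)) (NParam Lc M' rs (n + 1)) ℝ} (hW₀ : W₀ = towerGen Lc M' rs (n + 1))
    {W₁ W₂ : Matrix (↥(pbox (towerTorus Lc M' (n + 1))) × Fin (d + 1)) (NParam Lc M' rs (n + 1)) ℝ}
    (hW₁ : W₁ = Matrix.of fun (b : ↥(pbox (towerTorus Lc M' (n + 1))) × Fin (d + 1)) (e : NParam Lc M' rs (n + 1)) =>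
        -(c * h b * evalN Lc M' rs (n + 1) (fun b' : ↥(pbox (towerTorus Lc M' (n + 1))) × Fin (d + 1) => (b'.1 : Site (d + 1)) + unitVec b'.2) b e))
    (hW₂ : W₂ = Matrix.of fun (b : ↥(pbox (towerTorus Lc M' (n + 1))) × Fin (d + 1)) (e : NParam Lc M' rs (n + 1)) =>
        (c * h b) ^ 2 * evalN Lc M' rs (n + 1) (fun b' : ↥(pbox (towerTorus Lc M' (n + 1))) × Fin (d + 1) => (b'.1 : Site (d + 1)) + unitVec b'.2) b e) :
    secondVar (τ₁ * (W₀ : Matrix (↥(pbox (towerTorus Lc M' (n + 1))) × Fin (d + 1))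
          (Res (toSite (rs 0)) Lc M' ⊕ NParam Lc (fine Lc M') (fun k => rs (k + 1)) n) ℝ).toCols₂)
      (τ₁ * (W₁ : Matrix (↥(pbox (towerTorus Lc M' (n + 1))) × Fin (d + 1))
          (Res (toSite (rs 0)) Lc M' ⊕ NParam Lc (fine Lc M') (fun k => rs (k + 1)) n) ℝ).toCols₂)
      (τ₁ * (W₂ : Matrix (↥(pbox (towerTorus Lc M' (n + 1))) × Fin (d + 1))
          (Res (toSite (rs 0)) Lc M' ⊕ NParam Lc (fine Lc M') (fun k => rs (k + 1)) n) ℝ).toCols₂) = 0 := by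
  subst hτ₁ hW₀ hW₁ hW₂
  exact torus_uP_exp_tower Lc (fine Lc M') (fun k => rs (k + 1)) (fun k => toSite_mem_range (hrs (k + 1))) (dvd_fine M') n c h rfl rfl

end FineFP

end Summit.QuantumFields.BalabanUV.Beta.FP.TorusCompositeSliceOneShot

end
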